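import Summits.FinalStateConjecture.FinalStateConjecture.Theorems.BartnikGapSettlingBondiBartnikRigidityKillingDomainCausal
import Summits.FinalStateConjecture.FinalStateConjecture.Theorems.BartnikGapSettlingBondiBartnikRigidityKillingPropagationCausalSplice
import Literature.Geometry.Lorentzian.CausalityPushUp
import Literature.Geometry.Lorentzian.CauchyHypersurfaceGlobalHyperbolicity
import Literature.Geometry.Lorentzian.CauchyPieceDomain
import HarnessLib

/-!
# The faithful future domain of dependence is past-convex inside `I⁺(W)`; the initial boundary
# `S = C ∪ N_out` of the Killing domain is achronal and misses its interior — bricks for the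
# Killing PROPAGATION step β' (`stub_killingPropagation'`, K1a) of the line
# `direct-method-on-the-cone`, crux `BondiBartnikRigidity` (stmt-FinalStateConjecture-10807);
# worker betaA of lead c3

Causal bookkeeping (G0) of the Killing domain `killingDomain 𝒱 M p B Φ = D⁺(C ∪ N_out)`
(FAITHFUL `futureDomain`, `…DirectMethodDefs.lean`) of a thick collar core `C ⊆ ι(X)`:

* `mem_futureDomain_of_mem_causalPast` — for an achronal `W` (`I⁺(W) ∩ W = ∅`) and any
  `Spacetime 4`: `q ∈ D⁺(W)`, `y ≤ q`, `y ∈ I⁺(W)` imply `y ∈ D⁺(W)` (splice a past-endless causal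
  curve through `y` with the segment `y → q` keeping its tail,
  `exists_isFutureCausalCurveOn_trans_tail`; the new part lies in `I⁺(W)`, which misses `W`);
  registered brick `stub_killingPropagation_futureDomainConvexBelow` (its universe-`0` instance);
* `chronologicalFuture_inter_initialBoundary_eq_empty` — `S = C ∪ N_out` is achronal;
* `interior_killingDomain_inter_eq_empty` — `(killingDomain)° ∩ S = ∅`;
* `closure_interior_killingDomain_subset` — `closure (killingDomain)° ⊆ J⁺(ι X)`.

Everything is proved; no definitions, no named facts.  References: Hawking–Ellis 1973, §6.5
[HawkingEllis1973CUP]; O'Neill 1983, Ch. 14, Cor. 14.1, Lemma 14.22, Lemma 14.29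
[ONeillSemiRiemannian1983].
-/

noncomputable section

-- D-0017: single-problem summit, `Summit.<S>.<S>.…` by design (cf. lakefile `weak.linter.dupNamespace`).
set_option linter.dupNamespace false

open Set Filter Function Topology TopologicalSpace
open Literature.Geometry.Lorentzian
open scoped Manifold ContDiff Topology ENNReal

namespace Summit.FinalStateConjecture.FinalStateConjecture.Theorems.BondiBartnikRigidity.DirectMethod

namespace KillingPropagation

universe u

/-- **The faithful future domain of dependence is past-convex inside `I⁺(W)`** for an achronal
set `W` (`I⁺(W) ∩ W = ∅`): if `q ∈ D⁺(W)`, `y ≤ q` and `y ∈ I⁺(W)`, then `y ∈ D⁺(W)`. Given a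
past-endless causal curve `μ` through `y`, splice it (below a parameter `t₁ - ε₀` at which it is
still in the open set `I⁺(W)`) with the causal segment from `y` to `q`
(`exists_isFutureCausalCurveOn_trans_tail`): a past-endless causal curve through `q`, which meets
`W` at or before `q`; the meeting cannot take place on the new part, which lies in
`J⁺(μ(t₁ - ε₀)) ⊆ J⁺(I⁺ W) = I⁺(W)` (push-up, O'Neill 1983, Cor. 14.1), so `μ` itself meets `W`
before `y`. Hawking–Ellis 1973, §6.5 (properties of `D⁺`). [cite: HawkingEllis1973CUP, §6.5] -/
theorem mem_futureDomain_of_mem_causalPast (𝒮 : Spacetime.{u} 4) {W : Set 𝒮.carrier}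
    (hW : 𝒮.metric.chronologicalFuture 𝒮.timeOrientation W ∩ W = ∅)
    {q y : 𝒮.carrier} (hq : q ∈ futureDomain 𝒮 W)
    (hy : y ∈ 𝒮.metric.chronologicalFuture 𝒮.timeOrientation W)
    (hyq : q ∈ 𝒮.metric.causalFuture 𝒮.timeOrientation {y}) : y ∈ futureDomain 𝒮 W := by
  classical
  have hn1 : (1 : ℕ∞ω) ≤ ((⊤ : ℕ∞) : ℕ∞ω) := le_trans one_le_two (WithTop.coe_le_coe.mpr le_top)
  set g := 𝒮.metric
  set τ := 𝒮.timeOrientation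
  rcases hyq with hyq | ⟨y', hy', σ, a₂, b₂, hab₂, hσ, hσa, hσb⟩
  · rw [mem_singleton_iff] at hyq
    rw [← hyq]; exact hq
  rw [mem_singleton_iff] at hy'
  intro μ s hs hμ hend t₁ ht₁ hμt₁
  -- a parameter `t₋ < t₁` in `s`
  obtain ⟨tm, htm, htm1⟩ : ∃ t ∈ s, t < t₁ := by
    by_contra h
    push Not at h
    exact hend.2 _ (hasPastEndpoint_of_isLeast ⟨ht₁, h⟩)
  -- `μ` stays in `I⁺(W)` near `t₁`
  have hcont : ContinuousAt μ t₁ := (hμ t₁ ht₁).1.continuousAt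
  have hμt₁I : μ t₁ ∈ g.chronologicalFuture τ W := by rw [hμt₁]; exact hy
  obtain ⟨d, hd, hdI⟩ : ∃ d : ℝ, 0 < d ∧ ∀ t, |t - t₁| < d → μ t ∈ g.chronologicalFuture τ W := by
    have := hcont.preimage_mem_nhds
      ((LorentzianMetric.isOpen_chronologicalFuture_of_boundaryless g τ W).mem_nhds hμt₁I)
    rw [Metric.mem_nhds_iff] at this
    obtain ⟨d, hd, h⟩ := this
    exact ⟨d, hd, fun t ht ↦ h (by rwa [Metric.mem_ball, Real.dist_eq])⟩
  set ε₀ : ℝ := min (d / 2) ((t₁ - tm) / 2) with hε₀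
  have hε₀0 : 0 < ε₀ := lt_min (by positivity) (by linarith)
  have hε₀d : ε₀ ≤ d / 2 := min_le_left _ _
  have hε₀t : ε₀ ≤ (t₁ - tm) / 2 := min_le_right _ _
  set c : ℝ := t₁ - ε₀ with hc_def
  have htmc : tm < c := by rw [hc_def]; linarith
  have hct₁ : c ≤ t₁ := by rw [hc_def]; linarith
  have hcs : c ∈ s := hs.out htm ht₁ ⟨htmc.le, hct₁⟩
  have hμcI : μ c ∈ g.chronologicalFuture τ W := hdI c (by
    rw [hc_def, show t₁ - ε₀ - t₁ = -ε₀ by ring, abs_neg, abs_of_pos hε₀0]; linarith)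
  -- splice `μ|[tm, t₁]` with `σ`
  obtain ⟨ρ, b, hcb, hρ, htail, hρb⟩ := exists_isFutureCausalCurveOn_trans_tail (g := g) (τ := τ)
    hn1 htm1 hab₂ (hμ.mono (hs.out htm ht₁)) hσ (by rw [hμt₁, hσa, hy']) hε₀0
  -- the new parameter set
  set s' : Set ℝ := {t ∈ s | t ≤ c} ∪ Icc c b with hs'_def
  have hcs' : c ∈ s' := Or.inl ⟨hcs, le_rfl⟩
  have hbs' : b ∈ s' := Or.inr ⟨hcb.le, le_rfl⟩
  have hs'1 : ∀ t ∈ s', t ≤ c → t ∈ s := by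
    rintro t (ht | ht) htc
    · exact ht.1
    · have : t = c := le_antisymm htc ht.1
      rw [this]; exact hcs
  have hs' : s'.OrdConnected := by
    have h1 : ({t ∈ s | t ≤ c} : Set ℝ).OrdConnected :=
      ⟨fun u hu v hv w hw ↦ ⟨hs.out hu.1 hv.1 hw, hw.2.trans hv.2⟩⟩
    have hpre : IsPreconnected s' :=
      (isPreconnected_iff_ordConnected.2 h1).union c ⟨hcs, le_rfl⟩ ⟨le_rfl, hcb.le⟩
        (isPreconnected_iff_ordConnected.2 ordConnected_Icc)
    exact isPreconnected_iff_ordConnected.1 hpre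
  -- `ρ` is a future causal curve on `s'`
  have hρ' : g.IsFutureCausalCurveOn τ ρ s' := by
    intro t ht
    rcases le_or_gt tm t with htm' | htm'
    · have htb : t ≤ b := by
        rcases ht with ht | ht
        · exact ht.2.trans hcb.le
        · exact ht.2
      exact hρ t ⟨htm', htb⟩
    · have hts : t ∈ s := hs'1 t ht (htm'.le.trans htmc.le)
      have hev : ρ =ᶠ[𝓝 t] μ := by
        filter_upwards [Iio_mem_nhds (htm'.trans htmc)] with t' ht'
        exact htail t' (le_of_lt ht')
      obtain ⟨hd', hfd⟩ := hμ t hts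
      refine ⟨hev.mdifferentiableAt_iff.mpr hd', ?_⟩
      have hv : velocity (𝓡 4) ρ t = velocity (𝓡 4) μ t := by
        unfold velocity; rw [hev.mfderiv_eq]; rfl
      exact (LorentzianMetric.isFutureDirected_congr_point hev.eq_of_nhds hv).mpr hfd
  -- `ρ` is past endless on `s'`
  have hend' : IsPastEndless ρ s' := by
    refine ⟨⟨c, hcs'⟩, fun p hp ↦ hend.2 p ?_⟩
    have hcc : c ∈ s ∩ Iic c := ⟨hcs, self_mem_Iic⟩
    have he1 : ∀ t, t ≤ c → (t ∈ s' ↔ t ∈ s ∩ Iic c) := fun t htc ↦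
      Iff.intro (fun h ↦ ⟨hs'1 t h htc, htc⟩) (fun h ↦ Or.inl ⟨h.1, htc⟩)
    have he2 : ∀ t, t ≤ c → (t ∈ s ∩ Iic c ↔ t ∈ s) := fun t htc ↦
      Iff.intro (fun h ↦ h.1) (fun h ↦ ⟨h, htc⟩)
    have h1 : HasPastEndpoint ρ (s ∩ Iic c) p := (hasPastEndpoint_congr_set hcs' hcc he1 p).1 hp
    have h2 : HasPastEndpoint μ (s ∩ Iic c) p := by
      refine h1.congr fun t ↦ ?_
      exact htail t t.2.2
    exact (hasPastEndpoint_congr_set hcc hcs he2 p).1 h2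
  -- the spliced curve meets `W` at or before `q = ρ b`
  have hρbq : ρ b = q := hρb.trans hσb
  obtain ⟨t, hts', htb, htW⟩ := hq ρ s' hs' hρ' hend' b hbs' hρbq
  rcases le_or_gt t c with htc | htc
  · -- on the old part: `μ` meets `W` before `y`
    refine ⟨t, hs'1 t hts' htc, htc.trans hct₁, ?_⟩
    rw [← htail t htc]; exact htW
  · -- on the new part: impossible, it lies in `I⁺(W)`
    exfalso
    have htb' : t ≤ b := by
      rcases hts' with h | h
      · exact absurd h.2 (not_le.2 htc)
      · exact h.2
    have hρt : ρ t ∈ g.causalFuture τ {ρ c} :=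
      Or.inr ⟨ρ c, rfl, ρ, c, t, htc, hρ.mono (Icc_subset_Icc htmc.le htb'), rfl, rfl⟩
    have hρcI : ρ c ∈ g.chronologicalFuture τ W := by rw [htail c le_rfl]; exact hμcI
    have hρtI : ρ t ∈ g.chronologicalFuture τ W :=
      LorentzianMetric.mem_chronologicalFuture_of_mem_chronologicalFuture_of_mem_causalFuture_set
        hn1 hρcI hρt
    have : ρ t ∈ g.chronologicalFuture τ W ∩ W := ⟨hρtI, htW⟩
    rw [hW] at this
    exact this

section Development

variable {X : Type u} [TopologicalSpace X] [ChartedSpace E3 X] [IsManifold (𝓡 3) ∞ X]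
  [ConnectedSpace X] {D : InitialDataSet (𝓡 3) X}

/-- **`S = C ∪ N_out` is achronal**: `I⁺(S) ⊆ I⁺(J⁺ C) = I⁺(C)` misses `C ⊆ ι(X)` (a Cauchy
hypersurface is achronal, O'Neill 1983, Lemma 14.29) and misses `N_out ⊆ ∂J⁺(C)` (the open set
`I⁺(C) ⊆ J⁺(C)` lies in the interior of `J⁺(C)`). [cite: ONeillSemiRiemannian1983, Ch. 14, Lemma 14.29 (p. 415)] -/
theorem chronologicalFuture_inter_initialBoundary_eq_empty (𝒱 : VacuumCauchyDevelopment D)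
    (M : Fin 1 → ℝ) (p : 𝒱.carrier) (B : Fin 1 → ModelBackground)
    (Φ : ∀ i, (B i).domain → 𝒱.carrier) (hCX : collarCore M p B Φ ⊆ range 𝒱.embed) :
    𝒱.metric.chronologicalFuture 𝒱.timeOrientation (collarCore M p B Φ ∪
        (frontier (𝒱.metric.causalFuture 𝒱.timeOrientation (collarCore M p B Φ)) ∩
          𝒱.metric.causalFuture 𝒱.timeOrientation (Φ 0 '' shellSlab (B 0) (M 0)))) ∩
      (collarCore M p B Φ ∪
        (frontier (𝒱.metric.causalFuture 𝒱.timeOrientation (collarCore M p B Φ)) ∩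
          𝒱.metric.causalFuture 𝒱.timeOrientation (Φ 0 '' shellSlab (B 0) (M 0)))) = ∅ := by
  set g := 𝒱.metric
  set τ := 𝒱.timeOrientation
  set C := collarCore M p B Φ with hC
  have hn2 : (2 : ℕ∞ω) ≤ ((⊤ : ℕ∞) : ℕ∞ω) := WithTop.coe_le_coe.mpr le_top
  have hn1 : (1 : ℕ∞ω) ≤ ((⊤ : ℕ∞) : ℕ∞ω) := le_trans one_le_two hn2
  -- `I⁺(S) ⊆ I⁺(C)`
  have hIS : g.chronologicalFuture τ (C ∪ (frontier (g.causalFuture τ C) ∩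
      g.causalFuture τ (Φ 0 '' shellSlab (B 0) (M 0)))) ⊆ g.chronologicalFuture τ C := by
    refine (LorentzianMetric.chronologicalFuture_mono
      (collarCore_union_roof_subset_causalFuture 𝒱 M p B Φ)).trans ?_
    rw [LorentzianMetric.chronologicalFuture_causalFuture_eq_of_boundaryless hn1]
  refine Set.eq_empty_of_subset_empty fun x hx ↦ ?_
  have hxI : x ∈ g.chronologicalFuture τ C := hIS hx.1
  rcases hx.2 with hxC | ⟨hxfr, -⟩
  · -- `C ⊆ ι(X)` is achronal
    have hA : g.IsAchronal τ (range 𝒱.embed) :=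
      LorentzianMetric.IsCauchyHypersurface.isAchronal_holds hn2 𝒱.isCauchyHypersurface
    have hdisj := (LorentzianMetric.isAchronal_iff_disjoint (range 𝒱.embed)).1 hA
    exact Set.disjoint_left.1 hdisj (LorentzianMetric.chronologicalFuture_mono hCX hxI) (hCX hxC)
  · -- `I⁺(C)` is open inside `J⁺(C)`, hence inside its interior
    have hint : x ∈ interior (g.causalFuture τ C) :=
      interior_maximal (LorentzianMetric.chronologicalFuture_subset_causalFuture g τ C)
        (LorentzianMetric.isOpen_chronologicalFuture_of_boundaryless g τ C) hxI
    exact hxfr.2 hint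

/-- **The interior of the Killing domain misses the initial boundary**, `G ∩ S = ∅`: `G` is an
open subset of `J⁺(C)`, so it lies in the interior of `J⁺(C)` (off `∂J⁺(C) ⊇ N_out`), and a point
of `G ∩ C` would have points of `G ⊆ J⁺(ι X)` in its chronological past `I⁻(ι X)`, against
`J⁺(ι X) ∩ I⁻(ι X) = ∅` (O'Neill 1983, Lemma 14.29). [cite: ONeillSemiRiemannian1983, Ch. 14, Lemma 14.29 (p. 415)] -/
theorem interior_killingDomain_inter_eq_empty (𝒱 : VacuumCauchyDevelopment D) (M : Fin 1 → ℝ)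
    (p : 𝒱.carrier) (B : Fin 1 → ModelBackground) (Φ : ∀ i, (B i).domain → 𝒱.carrier)
    (hCX : collarCore M p B Φ ⊆ range 𝒱.embed) :
    interior (killingDomain 𝒱 M p B Φ) ∩
      (collarCore M p B Φ ∪
        (frontier (𝒱.metric.causalFuture 𝒱.timeOrientation (collarCore M p B Φ)) ∩
          𝒱.metric.causalFuture 𝒱.timeOrientation (Φ 0 '' shellSlab (B 0) (M 0)))) = ∅ := by
  set g := 𝒱.metric
  set τ := 𝒱.timeOrientation
  set C := collarCore M p B Φ with hC
  have hn2 : (2 : ℕ∞ω) ≤ ((⊤ : ℕ∞) : ℕ∞ω) := WithTop.coe_le_coe.mpr le_top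
  have hGJ : interior (killingDomain 𝒱 M p B Φ) ⊆ g.causalFuture τ C :=
    interior_subset.trans (killingDomain_subset_causalFuture 𝒱 M p B Φ)
  refine Set.eq_empty_of_subset_empty fun x hx ↦ ?_
  rcases hx.2 with hxC | ⟨hxfr, -⟩
  · -- a point of `G ≫ x`... in the chronological PAST of `x ∈ ι(X)` inside `G ⊆ J⁺(ι X)`
    have hcl : x ∈ closure (g.chronologicalPast τ {x}) :=
      g.mem_closure_chronologicalFuture_self τ.reverse BoundarylessManifold.isInteriorPoint
    obtain ⟨y, hyG, hyI⟩ := mem_closure_iff_nhds.mp hcl _ (isOpen_interior.mem_nhds hx.1)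
    have hyJ : y ∈ g.causalFuture τ (range 𝒱.embed) :=
      LorentzianMetric.causalFuture_mono hCX (hGJ hyG)
    have hyI' : y ∈ g.chronologicalPast τ (range 𝒱.embed) :=
      LorentzianMetric.chronologicalFuture_mono (singleton_subset_iff.2 (hCX hxC)) hyI
    exact Set.disjoint_left.1
      (LorentzianMetric.IsCauchyHypersurface.disjoint_causalFuture_chronologicalPast hn2
        𝒱.isCauchyHypersurface) hyJ hyI'
  · have hint : x ∈ interior (g.causalFuture τ C) := interior_maximal hGJ isOpen_interior hx.1
    exact hxfr.2 hint

/-- `closure G ⊆ J⁺(ι X)`: `G ⊆ D⁺(S) ⊆ J⁺(C) ⊆ J⁺(ι X)`, which is closed (O'Neill 1983,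
Lemma 14.22). [cite: ONeillSemiRiemannian1983, Ch. 14, Lemma 14.22 (p. 412)] -/
theorem closure_interior_killingDomain_subset (𝒱 : VacuumCauchyDevelopment D) (M : Fin 1 → ℝ)
    (p : 𝒱.carrier) (B : Fin 1 → ModelBackground) (Φ : ∀ i, (B i).domain → 𝒱.carrier)
    (hCX : collarCore M p B Φ ⊆ range 𝒱.embed) :
    closure (interior (killingDomain 𝒱 M p B Φ)) ⊆
      𝒱.metric.causalFuture 𝒱.timeOrientation (range 𝒱.embed) := by
  have hn2 : (2 : ℕ∞ω) ≤ ((⊤ : ℕ∞) : ℕ∞ω) := WithTop.coe_le_coe.mpr le_top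
  have hGJ : interior (killingDomain 𝒱 M p B Φ) ⊆
      𝒱.metric.causalFuture 𝒱.timeOrientation (range 𝒱.embed) :=
    interior_subset.trans ((killingDomain_subset_causalFuture 𝒱 M p B Φ).trans
      (LorentzianMetric.causalFuture_mono hCX))
  exact closure_minimal hGJ
    (LorentzianMetric.IsCauchyHypersurface.isClosed_causalFuture_set hn2 𝒱.isCauchyHypersurface)


end Development

end KillingPropagation

open KillingPropagation in
/-- **Registered brick `stub_killingPropagation_futureDomainConvexBelow` of
`stub_killingPropagation'` (K1a β')**: the faithful future domain of dependence of an achronal set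
is past-convex inside its chronological future (instance of `mem_futureDomain_of_mem_causalPast`).
[cite: HawkingEllis1973CUP, §6.5] -/
theorem stub_killingPropagation_futureDomainConvexBelow : ∀ (𝒮 : Spacetime.{0} 4) (W : Set 𝒮.carrier) (q y : 𝒮.carrier), 𝒮.metric.chronologicalFuture 𝒮.timeOrientation W ∩ W = ∅ → q ∈ futureDomain 𝒮 W → y ∈ 𝒮.metric.chronologicalFuture 𝒮.timeOrientation W → q ∈ 𝒮.metric.causalFuture 𝒮.timeOrientation {y} → y ∈ futureDomain 𝒮 W :=
  fun 𝒮 _ _ _ hW hq hy hyq ↦ mem_futureDomain_of_mem_causalPast 𝒮 hW hq hy hyq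

end Summit.FinalStateConjecture.FinalStateConjecture.Theorems.BondiBartnikRigidity.DirectMethod

end
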